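import Literature.Analysis.FluidPDE.Grujic2013SparsenessRegularityCriterion
import Literature.Analysis.FluidPDE.LerayHopf
import HarnessLib

/-!
# The "scaling gap" for sparseness of the vorticity components: a regularity criterion in
# `Z_{1/2}` and an a-priori bound in `Z_{2/5}` (Bradshaw–Farhat–Grujić 2019, Theorems 19 and 26)

Topic `Analysis/FluidPDE`. Source: Z. Bradshaw, A. Farhat, Z. Grujić, *An algebraic reduction of
the 'scaling gap' in the Navier–Stokes regularity problem*, Arch. Ration. Mech. Anal. **231** (2019)
1983–2005 = arXiv:1704.05546 [BradshawFarhatGrujic2018] (held, lit key `paper:arxiv-1704.05546`;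
read: §1 (Definitions 1, 3 of the classes `X_α`, `Z_α`, the max-norm convention, pp. 4–5), §2
(Theorems 8 and 10: real and complex `L^∞` theory for the vorticity, pp. 7–8), §3 (Definitions
12–13, 15, Propositions 17–18, the choice of `M`, **Theorem 19** and its proof, Remarks 20–21,
pp. 9–10), §4 (Definition 22, Lemma 24, **Theorem 26** and its proof, Remarks 27–28, pp. 11–12)).

The refereed successor of Grujić 2013 (`Grujic2013SparsenessRegularityCriterion.lean`, whose
Definition 4.1 = Definition 12 here, `Grujic2013.IsLinearlySparseAround`, and whose Solynin exponent
`Grujic2013.solyninExponent` are REUSED): the sparseness hypothesis is moved from the full vectorial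
super-level sets to those of the locally maximal COMPONENT `ω_j^±` (class `Z_{1/2}`, Theorem 19),
and an A-PRIORI sparseness of the same component super-level sets at the larger scale
`‖ω‖_∞^{−2/5}` (class `Z_{2/5}`, Theorem 26) is derived for Leray solutions from the energy
inequality alone. Cited by the NavierStokesRegularity theses `SelfMixingDichotomy` ("Thm 19") and
`ComplexTouchdown`; no decl stated either theorem (`lean search 'BradshawFarhatGrujic|Z_alpha|semiMixed|VolumeSparse'`,
2026-08-26).

No regularity claim about Navier–Stokes is made by this file beyond the printed theorems, recorded
as named facts (`def … : Prop`, cite-tagged, unproved here), with the printed definitions as Lean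
definitions carrying small proved API lemmas.

## What is printed (arXiv:1704.05546, verbatim up to notation; `ν = 1`)

§1, Definition 3 (p. 5): "(henceforth, the norm of a vector `v = (a, b, c)`, `|v|`, will be computed
as `max{|a|, |b|, |c|}`)". **Definition 12** (p. 9): "`S` is 1D `δ`-sparse around `x₀` at scale `r`
if there exists a unit vector `d` in `S²` such that `m¹(S ∩ (x₀ − rd, x₀ + rd))/(2r) ≤ δ`."
**Definition 13**: "`S` is 3D `δ`-sparse around `x₀` at scale `r` if
`m³(S ∩ B(x₀, r))/m³(B(x₀, r)) ≤ δ`." **Definition 15**: "Let `ω` be in `C([0, T*), L^∞)` where `T*`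
is the first possible blow-up time. A time `t` in `(0, T*)` is an escape time if
`‖ω(τ)‖_∞ > ‖ω(t)‖_∞` for any `τ` in `(t, T*)`."

**Theorem 10** (complex setting, p. 8). "Let the initial datum `ω₀` be in `L² ∩ L^∞`, and `M` a
constant larger than `1`. Then there is a constant `c(M) > 1` such that there exists a unique mild
solution `ω` in `C_w([0, T], L^∞)` where `T ≥ (1/c(M)) (1/‖ω₀‖_∞)`, and for any `t` in `(0, T]` the
solution `ω` is the `ℝ³`-restriction of a holomorphic function `ω` defined in the domain
`Ω_t = {x + iy ∈ ℂ³ : |y| < (1/√c(M)) √t}`; moreover, `‖ω(t)‖_{L^∞(Ω_t)} ≤ M ‖ω₀‖_∞`."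

P. 9: "for an escape time `t`, we consider a temporal point `s = s(t)` conforming to the requirement
`s ∈ [t + 1/(4c(M)‖ω(t)‖_∞), t + 1/(c(M)‖ω(t)‖_∞)]` (s); then, a lower bound on the radius of
spatial analyticity at `s` is given by `1/(2c(M)‖ω(t)‖_∞^{1/2})`. Moreover, since `t` is an escape
time, this lower bound can be replaced by `1/(2c(M)‖ω(s)‖_∞^{1/2})` …
`V^{j,±}_s = {x ∈ ℝ³ : ω_j^±(x, s) > (1/2M)‖ω(s)‖_∞}` (V)." "let `M` be the solution to the equation
`½h* + (1 − h*)M = 1` where `h* = (2/π) arcsin((1 − (3/4)^{2/3})/(1 + (3/4)^{2/3}))`, and let `c(M)`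
be as in Theorem 10 (note that `1 < M < 3/2`)."

**Theorem 19.** "Let `ω` be in `C([0, T*), L^∞)` where `T*` is the first possible blow-up time, and
assume, in addition, that `ω₀` is in `L²` … Let `t` be an escape time, and suppose that there exists
a temporal point `s = s(t)` as in (s) such that for any spatial point `x₀`, there exists a scale `ρ`,
`0 < ρ ≤ 1/(2c(M)‖ω(s)‖_∞^{1/2})` and a direction `d` with the property that the super-level set
`V^{j,±}_s` delineated in (V) is 1D `(3/4)^{1/3}`-sparse around `x₀` at scale `ρ`; here, the pair
`(j, ±)` is chosen according to the following selection criterion: `|ω(x₀, s)| = ω_j^±(x₀, s)`.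
Then `T*` is not a blow-up time." **Remark 20**: "it is enough that the condition on local 1D
sparseness holds at some `s(t)` for a single escape time `t`".

**Theorem 26.** "Let `u` be a Leray solution (a global-in-time weak solution satisfying the global
energy inequality), and assume that `ω` is in `C((0, T*), L^∞)` for some `T* > 0`. Then for any `τ`
in `(0, T*)` for which the scale `r*` defined below is less or equal to one, the super-level sets
`V^{j,±}_τ = {x ∈ ℝ³ : ω_j^±(x, τ) > (1/2M)‖ω(τ)‖_∞}` are 3D `3/4`-sparse around any spatial point
`x₀` at scale `r* = c(‖u₀‖₂) ‖ω(τ)‖_∞^{−2/5}`, where `c(‖u₀‖₂)` is a constant depending only on the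
energy at time `0`." (Proof: Lemma 24 — an `H^{-1}`-duality / semi-mixedness lemma — and
`‖ω(τ)‖_{H^{-1}} ≤ ‖u(τ)‖₂ ≤ ‖u₀‖₂`; the viscosity does not enter.)

## Transcription into the tree's vocabulary (as in `Grujic2013SparsenessRegularityCriterion.lean`)

* `ℝ³ = EuclideanSpace ℝ (Fin 3)`, time first, `ω = curl (u t)`; the paper's max-norm of a vector is
  `BFG2019.maxNorm v = ⨆ j, |v j|`, and `‖ω(t)‖_∞ = ⨆ x, maxNorm (ω(x, t))` (`BFG2019.vortSup`);
  `ω_j^+ = max(ω_j, 0)`, `ω_j^− = max(−ω_j, 0)` are written with a sign `σ = ±1`: for a threshold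
  `L ≥ 0`, `ω_j^σ(x) > L ↔ σ ω_j(x) > L`, and the selection "`|ω(x₀, s)| = ω_j^±(x₀, s)`" reads
  `σ ω_j(x₀, s) = maxNorm (ω(x₀, s))` (`BFG2019.componentSuperlevel`).
* Viscosity `ν > 0` by the scaling `v(x, s) = ν⁻¹u(x, s/ν)`: the vorticity time window
  `1/(c(M)‖ω(t)‖_∞)` is `ν`-free, the analyticity radius is `√(ν(s − t)/c(M))`, and the scale bound
  of Theorem 19 becomes `ρ ≤ √ν/(2c(M)‖ω(s)‖_∞^{1/2})`; Theorem 26 is `ν`-free.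
* "`c(M)` as in Theorem 10": exactly as for Grujić 2013, the proof of Theorem 19 uses the equations
  only through Theorem 10 restarted at `t` (holomorphic extension of `ω(s)` to the tube of radius
  `√(ν(s−t)/c(M))` with the COMPONENTWISE bound `M‖ω(t)‖_∞` for `t < s ≤ t + 1/(c(M)‖ω(t)‖_∞)`); we
  take `cM > 1` as a parameter and that restart property of `u` as an explicit hypothesis
  (`BFG2019.HasComponentAnalyticRestarts cM ν T u`, stated with the absolute `M = BFG2019.bfgM`),
  so the fact is the printed theorem with its appeal to Theorem 10 made explicit.
* "`ω ∈ C([0, T*), L^∞)`, `T*` the first possible blow-up time": a classical unforced solution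
  `IsClassicalNSSolutionOn (Ioo 0 T) ν 0 u p` with bounded vorticity slices; "`T*` is not a blow-up
  time" is recorded as: `‖ω(τ)‖_∞` stays bounded for `τ ∈ (t, T)`. The hypothesis `ω₀ ∈ L²` only
  serves Theorem 10 (a "soft assumption", p. 7) and is absorbed in the restart hypothesis. The time
  `s` is required to lie in `(t, T)` (if the window from `t` reaches `T`, boundedness up to `T` is
  the restart bound itself).
* Theorem 26: "Leray solution" = `IsLerayHopfOn T ν 0 u₀ u` (energy inequality from `0`, which is
  all the proof uses) for a classical solution on `(0, T)` (so that `ω(τ)` is the continuous bounded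
  slice); "`c(‖u₀‖₂)` depending only on the energy at time 0" = a function `c : ℝ → ℝ`, positive,
  of `‖u₀‖_{L²}`, quantified before the solution; `M = bfgM`.

## Contents

* `BFG2019.maxNorm`, `BFG2019.vortSup`, `BFG2019.componentSuperlevel` (`V^{j,±}` with a threshold),
  `BFG2019.IsVolumeSparseAround` (Definition 13), `BFG2019.bfgM` (the absolute `M`; proved
  `one_lt_bfgM`), `BFG2019.HasComponentAnalyticRestarts` (Theorem 10 as a restart schema).
* `bradshawFarhatGrujic2019_componentSparseness_regularity` — **Theorem 19** (named fact).
* `bradshawFarhatGrujic2019_apriori_componentSparseness` — **Theorem 26** (named fact).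

## References

* Z. Bradshaw, A. Farhat, Z. Grujić, Arch. Ration. Mech. Anal. 231 (2019) 1983–2005 =
  arXiv:1704.05546: Defs. 1, 3 (pp. 4–5), Thms. 8, 10 (pp. 7–8), Defs. 12–13, 15, Props. 17–18,
  Thm. 19, Rmks. 20–21 (pp. 9–10), Def. 22, Lemma 24, Thm. 26, Rmks. 27–28 (pp. 11–12).
  [BradshawFarhatGrujic2018]
* Z. Grujić, Nonlinearity 26 (2013) 289–296 (Definition 12 = its Def. 4.1; tree
  `Grujic2013.IsLinearlySparseAround`, `Grujic2013.solyninExponent`). [Grujic2012]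
-/

noncomputable section

open MeasureTheory Set Function Filter Metric
open scoped ENNReal
open Literature.Analysis.FunctionSpaces.EuclideanSpace (complexify)

namespace Literature.Analysis.FluidPDE

namespace BFG2019

/-- The paper's norm of a vector `v = (a, b, c) ∈ ℝ³`: `|v| = max{|a|, |b|, |c|}` (§1, Definition 3:
"henceforth, the norm of a vector … will be computed as `max{|a|, |b|, |c|}`").
[cite: BradshawFarhatGrujic2018, Def. 3 (arXiv:1704.05546, p. 5)] -/
def maxNorm (v : EuclideanSpace ℝ (Fin 3)) : ℝ :=
  ⨆ j : Fin 3, |v j|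

/-- Each component is bounded by the max-norm. [cite: BradshawFarhatGrujic2018, Def. 3 (arXiv:1704.05546, p. 5)] -/
theorem abs_apply_le_maxNorm (v : EuclideanSpace ℝ (Fin 3)) (j : Fin 3) : |v j| ≤ maxNorm v :=
  le_ciSup (f := fun i : Fin 3 => |v i|) (Set.finite_range _).bddAbove j

/-- The max-norm is nonnegative. [cite: BradshawFarhatGrujic2018, Def. 3 (arXiv:1704.05546, p. 5)] -/
theorem maxNorm_nonneg (v : EuclideanSpace ℝ (Fin 3)) : 0 ≤ maxNorm v :=
  (abs_nonneg (v 0)).trans (abs_apply_le_maxNorm v 0)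

/-- The max-norm is dominated by the Euclidean norm (each `|v j| ≤ ‖v‖`). [cite: BradshawFarhatGrujic2018, Def. 3 (arXiv:1704.05546, p. 5)] -/
theorem maxNorm_le_norm (v : EuclideanSpace ℝ (Fin 3)) : maxNorm v ≤ ‖v‖ :=
  ciSup_le fun j => by
    simpa using PiLp.norm_apply_le v j

/-- `‖ω(t)‖_∞` in the paper's max-norm convention: `sup_x max_j |ω_j(x, t)|`, `ω = curl u(t, ·)`
(meaningful for a bounded slice; `⨆` of an unbounded family is junk).
[cite: BradshawFarhatGrujic2018, Def. 3 and Def. 15 (arXiv:1704.05546, pp. 5, 9)] -/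
def vortSup (u : ℝ → EuclideanSpace ℝ (Fin 3) → EuclideanSpace ℝ (Fin 3)) (t : ℝ) : ℝ :=
  ⨆ x : EuclideanSpace ℝ (Fin 3), maxNorm (curl (u t) x)

/-- The component super-level set `{x : ω_j^σ(x, s) > L}` of the positive (`σ = 1`) or negative
(`σ = −1`) part of the `j`-th vorticity component at time `s`, for a threshold `L ≥ 0`
(`ω_j^+ = max(ω_j, 0) > L ↔ ω_j > L`, `ω_j^− = max(−ω_j, 0) > L ↔ −ω_j > L`); the sets
`V^{j,±}_s` of (V) are `componentSuperlevel u s j σ (‖ω(s)‖_∞/(2M))`.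
[cite: BradshawFarhatGrujic2018, (V) (arXiv:1704.05546, p. 9)] -/
def componentSuperlevel (u : ℝ → EuclideanSpace ℝ (Fin 3) → EuclideanSpace ℝ (Fin 3)) (s : ℝ)
    (j : Fin 3) (σ : ℝ) (L : ℝ) : Set (EuclideanSpace ℝ (Fin 3)) :=
  {x | L < σ * (curl (u s) x) j}

/-- **Definition 13 (3D `δ`-sparseness around a point at scale `r`)**: the fraction of the ball
`B(x₀, r)` occupied by `S` is at most `δ`: `m³(S ∩ B(x₀, r)) ≤ δ · m³(B(x₀, r))`.
[cite: BradshawFarhatGrujic2018, Def. 13 (arXiv:1704.05546, p. 9)] -/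
def IsVolumeSparseAround (S : Set (EuclideanSpace ℝ (Fin 3))) (x₀ : EuclideanSpace ℝ (Fin 3))
    (r δ : ℝ) : Prop :=
  volume (S ∩ ball x₀ r) ≤ ENNReal.ofReal δ * volume (ball x₀ r)

/-- Unfolding Definition 13. [cite: BradshawFarhatGrujic2018, Def. 13 (arXiv:1704.05546, p. 9)] -/
theorem isVolumeSparseAround_iff {S : Set (EuclideanSpace ℝ (Fin 3))}
    {x₀ : EuclideanSpace ℝ (Fin 3)} {r δ : ℝ} :
    IsVolumeSparseAround S x₀ r δ ↔
      volume (S ∩ ball x₀ r) ≤ ENNReal.ofReal δ * volume (ball x₀ r) :=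
  Iff.rfl

/-- 3D sparseness is inherited by subsets and survives enlarging `δ`.
[cite: BradshawFarhatGrujic2018, Def. 13 (arXiv:1704.05546, p. 9)] -/
theorem IsVolumeSparseAround.mono {S S' : Set (EuclideanSpace ℝ (Fin 3))}
    {x₀ : EuclideanSpace ℝ (Fin 3)} {r δ δ' : ℝ} (h : IsVolumeSparseAround S x₀ r δ) (hS : S' ⊆ S)
    (hδ : δ ≤ δ') : IsVolumeSparseAround S' x₀ r δ' :=
  (measure_mono (inter_subset_inter_left _ hS)).trans
    (h.trans (mul_le_mul' (ENNReal.ofReal_le_ofReal hδ) le_rfl))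

/-- The absolute constant `h* = (2/π) arcsin((1 − (3/4)^{2/3})/(1 + (3/4)^{2/3}))`: Solynin's exponent
`h(δ)` (`Grujic2013.solyninExponent`) at the sparseness ratio `δ = (3/4)^{1/3}` (so that
`δ² = (3/4)^{2/3}`). [cite: BradshawFarhatGrujic2018, §3 before Thm. 19 (arXiv:1704.05546, p. 9)] -/
def hStar : ℝ :=
  Grujic2013.solyninExponent ((3 / 4 : ℝ) ^ (1 / 3 : ℝ))

/-- `h* ∈ (0, 1)` (the ratio `(3/4)^{1/3}` lies in `(0, 1)`).
[cite: BradshawFarhatGrujic2018, §3 before Thm. 19 (arXiv:1704.05546, p. 9)] -/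
theorem hStar_mem_Ioo : hStar ∈ Ioo (0 : ℝ) 1 := by
  have h0 : (0 : ℝ) < (3 / 4 : ℝ) ^ (1 / 3 : ℝ) := Real.rpow_pos_of_pos (by norm_num) _
  have h1 : (3 / 4 : ℝ) ^ (1 / 3 : ℝ) < 1 :=
    Real.rpow_lt_one (by norm_num) (by norm_num) (by norm_num)
  exact Grujic2013.solyninExponent_mem_Ioo h0 h1

/-- **The absolute constant `M`** of Theorems 19 and 26: "let `M` be the solution to the equation
`½h* + (1 − h*)M = 1`", i.e. `M = (2 − h*)/(2(1 − h*))` ("note that `1 < M < 3/2`").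
[cite: BradshawFarhatGrujic2018, §3 before Thm. 19 (arXiv:1704.05546, p. 9)] -/
def bfgM : ℝ :=
  (2 - hStar) / (2 * (1 - hStar))

/-- `M` solves the printed equation `½h* + (1 − h*)M = 1`.
[cite: BradshawFarhatGrujic2018, §3 before Thm. 19 (arXiv:1704.05546, p. 9)] -/
theorem bfgM_eq : hStar / 2 + (1 - hStar) * bfgM = 1 := by
  have h := hStar_mem_Ioo
  have hne : (1 : ℝ) - hStar ≠ 0 := by linarith [h.2]
  unfold bfgM
  rw [mul_div_assoc', div_add_div _ _ (two_ne_zero) (mul_ne_zero two_ne_zero hne),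
    div_eq_one_iff_eq (mul_ne_zero two_ne_zero (mul_ne_zero two_ne_zero hne))]
  ring

/-- `1 < M` (since `0 < h* < 1`). [cite: BradshawFarhatGrujic2018, §3 before Thm. 19 (arXiv:1704.05546, p. 9)] -/
theorem one_lt_bfgM : 1 < bfgM := by
  have h := hStar_mem_Ioo
  have hpos : 0 < 2 * (1 - hStar) := by nlinarith [h.2]
  unfold bfgM
  rw [lt_div_iff₀ hpos]
  nlinarith [h.1]

/-- **Theorem 10 (complex setting) as a restart property of `u` on `(0, T)`** ("`c(M)` as in Theorem
10"), in the max-norm convention and with `M = bfgM`: for every `t ∈ (0, T)` and every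
`s ∈ (t, T)` with `s ≤ t + 1/(c(M)‖ω(t)‖_∞)`, the slice `ω(s) = curl u(s, ·)` has a holomorphic
extension `W` to the open tube of radius `√(ν(s − t)/c(M))` (`complexTube`) agreeing with `ω(s)` on
the real points, with every component bounded by `M‖ω(t)‖_∞` on the tube. For the mild solution
from `ω₀ ∈ L² ∩ L^∞` this is Theorem 10 restarted at `t` (uniqueness); it is the only use of the
equations in the proof of Theorem 19.
[cite: BradshawFarhatGrujic2018, Thm. 10 (arXiv:1704.05546, p. 8) and §3 p. 9] -/
def HasComponentAnalyticRestarts (cM ν T : ℝ)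
    (u : ℝ → EuclideanSpace ℝ (Fin 3) → EuclideanSpace ℝ (Fin 3)) : Prop :=
  ∀ t ∈ Ioo 0 T, ∀ s ∈ Ioo t T, s ≤ t + 1 / (cM * vortSup u t) →
    ∃ W : EuclideanSpace ℂ (Fin 3) → EuclideanSpace ℂ (Fin 3),
      DifferentiableOn ℂ W (complexTube (Fin 3) (Real.sqrt (ν * (s - t) / cM))) ∧
      (∀ x : EuclideanSpace ℝ (Fin 3), W (complexify x) = complexify (curl (u s) x)) ∧
      ∀ z ∈ complexTube (Fin 3) (Real.sqrt (ν * (s - t) / cM)), ∀ j : Fin 3,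
        ‖W z j‖ ≤ bfgM * vortSup u t

end BFG2019

/-- **Bradshaw–Farhat–Grujić 2019, Theorem 19 (1D sparseness of the locally maximal vorticity
COMPONENT super-level set at the scale of the analyticity radius, at one time after an escape time,
prevents blow-up).** Let `cM > 1`, `ν > 0`, and let `(u, p)` be a classical unforced Navier–Stokes
solution on `ℝ³ × (0, T)` with bounded vorticity slices, `ω = curl u`, `‖ω(t)‖_∞ = sup_x max_j |ω_j|`
(`BFG2019.vortSup`), having the restart form of Theorem 10 with constant `cM`
(`BFG2019.HasComponentAnalyticRestarts cM ν T u`). Let `t ∈ (0, T)` be an **escape time**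
(`‖ω(τ)‖_∞ > ‖ω(t)‖_∞` for all `τ ∈ (t, T)`) and `s ∈ (t, T)` a time in the window
`[t + 1/(4cM‖ω(t)‖_∞), t + 1/(cM‖ω(t)‖_∞)]`. Suppose that for every point `x₀` there are a scale
`0 < ρ ≤ √ν/(2cM‖ω(s)‖_∞^{1/2})` and a locally maximal signed component — `j`, `σ = ±1` with
`σ ω_j(x₀, s) = max_i |ω_i(x₀, s)|` — whose super-level set
`V^{j,σ}_s = {x : σ ω_j(x, s) > ‖ω(s)‖_∞/(2M)}` (`M = BFG2019.bfgM`) is 1D `(3/4)^{1/3}`-sparse around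
`x₀` at scale `ρ` (`Grujic2013.IsLinearlySparseAround`, Definition 12). Then `T` is not a blow-up
time: `‖ω(τ)‖_∞` stays bounded for `τ ∈ (t, T)`. Printed with `ν = 1`, for `ω ∈ C([0,T*), L^∞)`
with `ω₀ ∈ L²` and `c(M)` of Theorem 10; see the module docstring for the transcription. Not proved
here; users take `(h : bradshawFarhatGrujic2019_componentSparseness_regularity)`.
[cite: BradshawFarhatGrujic2018, Thm. 19 with Defs. 12, 15, (s), (V) and Thm. 10 (arXiv:1704.05546, pp. 8–10)] -/
def bradshawFarhatGrujic2019_componentSparseness_regularity : Prop :=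
  ∀ ⦃cM ν T : ℝ⦄, 1 < cM → 0 < ν → 0 < T →
    ∀ ⦃u : ℝ → EuclideanSpace ℝ (Fin 3) → EuclideanSpace ℝ (Fin 3)⦄
      ⦃p : ℝ → EuclideanSpace ℝ (Fin 3) → ℝ⦄,
    IsClassicalNSSolutionOn (Ioo 0 T) ν 0 u p →
    (∀ τ ∈ Ioo 0 T, BddAbove (Set.range fun x => BFG2019.maxNorm (curl (u τ) x))) →
    BFG2019.HasComponentAnalyticRestarts cM ν T u →
    ∀ ⦃t s : ℝ⦄, t ∈ Ioo 0 T →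
    -- `t` is an escape time
    (∀ τ ∈ Ioo t T, BFG2019.vortSup u t < BFG2019.vortSup u τ) →
    -- `s = s(t)` in the window (s), inside the lifespan
    s ∈ Ioo t T →
    s ∈ Icc (t + 1 / (4 * cM * BFG2019.vortSup u t)) (t + 1 / (cM * BFG2019.vortSup u t)) →
    -- 1D sparseness of the locally maximal component super-level set around every point
    (∀ x₀ : EuclideanSpace ℝ (Fin 3), ∃ ρ : ℝ, 0 < ρ ∧
      ρ ≤ Real.sqrt ν / (2 * cM * Real.sqrt (BFG2019.vortSup u s)) ∧
      ∃ (j : Fin 3) (σ : ℝ), (σ = 1 ∨ σ = -1) ∧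
        σ * (curl (u s) x₀) j = BFG2019.maxNorm (curl (u s) x₀) ∧
        Grujic2013.IsLinearlySparseAround
          (BFG2019.componentSuperlevel u s j σ (BFG2019.vortSup u s / (2 * BFG2019.bfgM))) x₀ ρ
          ((3 / 4 : ℝ) ^ (1 / 3 : ℝ))) →
    -- `T` is not a blow-up time
    ∃ B : ℝ, ∀ τ ∈ Ioo t T, BFG2019.vortSup u τ ≤ B

/-- **Bradshaw–Farhat–Grujić 2019, Theorem 26 (a-priori 3D sparseness of the vorticity component
super-level sets at scale `‖ω‖_∞^{−2/5}`).** There is a positive function `c` of the initial energy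
such that: for every `ν > 0`, `T > 0`, every Leray–Hopf solution `u` of the unforced Navier–Stokes
equations on `ℝ³ × [0, T)` from `u₀` (`IsLerayHopfOn T ν 0 u₀ u`) which is classical on `(0, T)`
with bounded vorticity slices, and every `τ ∈ (0, T)` at which the scale
`r* = c(‖u₀‖_{L²}) ‖ω(τ)‖_∞^{−2/5}` is `≤ 1`, each of the six super-level sets
`V^{j,±}_τ = {x : ±ω_j(x, τ) > ‖ω(τ)‖_∞/(2M)}` (`M = BFG2019.bfgM`, max-norm convention) is 3D
`3/4`-sparse around every point `x₀` at scale `r*` (`BFG2019.IsVolumeSparseAround`, Definition 13).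
("the best a priori bound available is `ω ∈ X_{1/3}` … [this gives] an a priori bound in `Z_{2/5}`";
the viscosity does not enter the printed proof: `‖ω(τ)‖_{H^{-1}} ≤ ‖u(τ)‖₂ ≤ ‖u₀‖₂` and Lemma 24.)
Not proved here; users take `(h : bradshawFarhatGrujic2019_apriori_componentSparseness)`.
[cite: BradshawFarhatGrujic2018, Thm. 26 with Def. 13, Lemma 24, Rmks. 27–28 (arXiv:1704.05546, pp. 11–12)] -/
def bradshawFarhatGrujic2019_apriori_componentSparseness : Prop :=
  ∃ c : ℝ → ℝ, (∀ E, 0 < c E) ∧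
    ∀ ⦃ν T : ℝ⦄, 0 < ν → 0 < T →
    ∀ ⦃u₀ : EuclideanSpace ℝ (Fin 3) → EuclideanSpace ℝ (Fin 3)⦄
      ⦃u : ℝ → EuclideanSpace ℝ (Fin 3) → EuclideanSpace ℝ (Fin 3)⦄
      ⦃p : ℝ → EuclideanSpace ℝ (Fin 3) → ℝ⦄,
    IsLerayHopfOn T ν 0 u₀ u →
    IsClassicalNSSolutionOn (Ioo 0 T) ν 0 u p →
    ∀ ⦃τ : ℝ⦄, τ ∈ Ioo 0 T →
    BddAbove (Set.range fun x => BFG2019.maxNorm (curl (u τ) x)) →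
    c (eLpNorm u₀ 2 volume).toReal / BFG2019.vortSup u τ ^ (2 / 5 : ℝ) ≤ 1 →
    ∀ (x₀ : EuclideanSpace ℝ (Fin 3)) (j : Fin 3) (σ : ℝ), σ = 1 ∨ σ = -1 →
      BFG2019.IsVolumeSparseAround
        (BFG2019.componentSuperlevel u τ j σ (BFG2019.vortSup u τ / (2 * BFG2019.bfgM))) x₀
        (c (eLpNorm u₀ 2 volume).toReal / BFG2019.vortSup u τ ^ (2 / 5 : ℝ)) (3 / 4)

end Literature.Analysis.FluidPDE

end
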